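import Literature.Computability.Cryptography.ShorRoundFP
import Literature.Computability.Cryptography.ShorOrdPost
import Literature.Computability.Complexity.FPStringBricks
import HarnessLib

/-!
# The step function of Shor's classical oracle computation is polynomial time
(`Shor1997.shorComp_isPolyTime` discharged)

Family `PQC` (trunk `CryptoQuantFine`); last companion of the chain
`ShorClassicalOracle` → `ShorReplay` → `ShorRoundFP` for the programming fact
`Shor1997.shorComp_isPolyTime` (`ShorClassicalOracle.lean`), one of the seven named facts of
`ShorTheoremAssembly.FACT_mem_BQP_of_facts` (Shor 1997, §5: "a polynomial (in `log n`) amount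
of post-processing time on a classical computer", p. 13 of arXiv quant-ph/9508027v2; the
classical reduction around the order-finding subroutine, pp. 15–16). The G01 step function of
the oracle algorithm `toOracleAlg shorComp` is `Shor1997.shorStep` (`ShorReplay.step_shorComp`):
parse `⟨x, c⟩`, answer at once for `n ≤ 1`, otherwise replay `rounds |x|` rounds of the
work-list machine against the recorded answers and report the pending order query or the sorted
list of numbers declared prime. This file writes that function in the brick algebra
(`BrickAlgebra.lean`) around the round function `ShorFP.roundF` of `ShorRoundFP.lean`:

* `canonF` — the canonical numeral `encodeNat (decodeNat x)` of an arbitrary string (Mathlib's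
  `decodeNat` reads a leading `1` into a string ending in `0`);
* `initF` — the initial record `recOf x c as [(n, T)] [] []` from the coded pair
  `⟨⟨x, c⟩, ⟨1^{|as|}, encList as⟩⟩` (the `listBool` code of the transcript);
* `iterF` — `rounds |x| = 64 (|x| + 1)²` rounds of `roundF` (`iterate_mem_FP_of_growth` with
  `fstF_roundF`, `length_roundF_le`), and **`iterate_roundF_wrunR`**: on the initial record the
  rounds realise `Shor1997.wrunR` (invariant: every work-list number is `≥ 1` and divides `n`, so
  the cap `size m ≤ |x| + 1` of `roundF_recOf_wstepR` holds), the coin blocks read by the rounds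
  being the blocks `Xof (coinBlocks R B c)` of the specification (`Xof_coinBlocks`);
* `outF` — the read-out: `0 q` for a pending query `q`, else `1` followed by the `listBool` code
  of the sorted `done` list (`Brick.isortFn`; `isortModel_map_encodeNat`: the brick's insertion
  sort agrees with `List.insertionSort` on canonical numerals);
* `stepStr`, `stepStr_mem_FP`, **`stepStr_apply`** (it computes the `sumBool` code of
  `shorStep`), and **`shorComp_isPolyTime_holds : Shor1997.shorComp_isPolyTime`**.

## References

* P. W. Shor, *Polynomial-time algorithms for prime factorization and discrete logarithms on a
  quantum computer*, SIAM J. Comput. 26 (1997) 1484–1509, §5 (pp. 13, 15–16 of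
  arXiv:quant-ph/9508027v2: the classical parts of the algorithm are polynomial time).
* S. Arora, B. Barak, *Computational Complexity: A Modern Approach*, CUP 2009, §1.3 (closure of
  polynomial time under composition and bounded loops), §3.4 (oracle machines).
-/

noncomputable section

namespace Literature.Computability.Cryptography

namespace ShorFP

open _root_.Computability Polynomial Complexity Complexity.Brick Shor1997

/-! ### The transcript code -/

/-- The `listBool` code of a list of strings is `⟨1^{|as|}, encList as⟩`. [folklore] -/
theorem listBool_encode_eq_encList (as : List (List Bool)) :
    (encodingList Bool).listBool.encode as = boolPair (unaryEncodeNat as.length) (encList as) := by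
  change boolPair (unaryEncodeNat as.length) (as.foldr (fun a acc => boolPair ((encodingList Bool).encode a) acc) []) = _
  congr 1
  induction as with
  | nil => rfl
  | cons a as ih => rw [List.foldr_cons, ih]; rfl

/-! ### The coin blocks of the specification are the blocks read by the rounds -/

/-- `bitsToNat` of a function table. [folklore] -/
theorem bitsToNat_ofFn : ∀ {B : ℕ} (f : Fin B → Bool),
    bitsToNat (List.ofFn f) = ∑ i : Fin B, (f i).toNat * 2 ^ (i : ℕ)
  | 0, f => by simp
  | B + 1, f => by
    rw [List.ofFn_succ, bitsToNat_cons, bitsToNat_ofFn, Fin.sum_univ_succ]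
    simp only [Fin.val_zero, pow_zero, mul_one, Fin.val_succ, pow_succ]
    rw [Finset.mul_sum]
    congr 1
    exact Finset.sum_congr rfl fun i _ => by ring

/-- The padded block as a function table. [folklore] -/
theorem takeD_eq_ofFn (B : ℕ) (l : List Bool) :
    List.takeD B l false = List.ofFn fun i : Fin B => l.getD i false := by
  apply List.ext_getElem
  · simp
  · intro i h1 h2
    rw [List.getElem_ofFn]
    have hi : i < B := by simpa using h2
    have := getD_takeD B l i hi
    rw [List.getD_eq_getElem?_getD, List.getElem?_eq_getElem h1, Option.getD_some] at this
    exact this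

/-- **The blocks of the specification are the blocks read by the rounds**: for `t < R`,
`Xof (coinBlocks R B c) t = bitsToNat (takeD B (c ⇂ B t) 0)`. [folklore] -/
theorem Xof_coinBlocks {R B t : ℕ} (c : List Bool) (ht : t < R) :
    Xof (coinBlocks R B c) t = bitsToNat (List.takeD B (c.drop (B * t)) false) := by
  have hval : ∀ b : Bool, ((finTwoEquiv.symm b : Fin 2) : ℕ) = b.toNat := fun b => by cases b <;> rfl
  rw [Xof, dif_pos ht, Cryptography.blockVal, blockEquiv, takeD_eq_ofFn, bitsToNat_ofFn]
  simp only [Equiv.trans_apply, finFunctionFinEquiv_apply, Equiv.arrowCongr_apply, Equiv.refl_symm,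
    Equiv.coe_refl, Function.comp_apply, id_eq, hval]
  refine Finset.sum_congr rfl fun i _ => ?_
  congr 2
  simp [coinBlocks, List.getD_eq_getElem?_getD, List.getElem?_drop]

/-! ### The invariant of the replayed work list -/

/-- Every number of the work list is `≥ 1` and divides `n`. [folklore] -/
def TodoOK (n : ℕ) (todo : List (ℕ × ℕ)) : Prop := ∀ e ∈ todo, 1 ≤ e.1 ∧ e.1 ∣ n

/-- A divisor returned by the replayed attempt divides `m` and is `≥ 1` (on arbitrary recorded
answers it need not be a nontrivial divisor). [folklore] -/
theorem splitStepR_some {m X d : ℕ} {as as' : List (List Bool)} (hm : 1 ≤ m)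
    (h : splitStepR m X as = Sum.inr (some d, as')) : 1 ≤ d ∧ d ∣ m := by
  unfold splitStepR at h
  by_cases he : Even m
  · rw [if_pos he] at h
    simp only [Sum.inr.injEq, Prod.mk.injEq] at h
    obtain ⟨h7, -⟩ := h
    by_cases h2 : m = 2
    · simp [h2] at h7
    · rw [if_neg h2] at h7
      cases h7
      exact ⟨by norm_num, even_iff_two_dvd.1 he⟩
  rw [if_neg he] at h
  by_cases hpp : ppBase m < m
  · rw [if_pos hpp] at h
    simp only [Sum.inr.injEq, Prod.mk.injEq, Option.some.injEq] at h
    obtain ⟨rfl, -⟩ := h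
    exact ⟨Nat.pos_of_dvd_of_pos (ppBase_dvd m) hm, ppBase_dvd m⟩
  rw [if_neg hpp] at h
  dsimp only at h
  by_cases h0 : X % 2 ^ m.size = 0 ∨ m ≤ X % 2 ^ m.size
  · rw [if_pos h0] at h; simp at h
  rw [if_neg h0] at h
  by_cases hg : 1 < Nat.gcd (X % 2 ^ m.size) m
  · rw [if_pos hg] at h
    simp only [Sum.inr.injEq, Prod.mk.injEq, Option.some.injEq] at h
    obtain ⟨rfl, -⟩ := h
    exact ⟨Nat.gcd_pos_of_pos_right _ hm, Nat.gcd_dvd_right _ _⟩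
  rw [if_neg hg] at h
  rcases hor : orderR (X % 2 ^ m.size) m m.size as with q | ⟨r, as''⟩
  · rw [hor] at h; simp at h
  · rw [hor] at h
    dsimp only at h
    by_cases hsh : Even r ∧ ¬ m ∣ (X % 2 ^ m.size) ^ (r / 2) + 1
    · rw [if_pos hsh] at h
      simp only [Sum.inr.injEq, Prod.mk.injEq, Option.some.injEq] at h
      obtain ⟨rfl, -⟩ := h
      exact ⟨Nat.gcd_pos_of_pos_right _ hm, Nat.gcd_dvd_right _ _⟩
    · rw [if_neg hsh] at h; simp at h

/-- One replayed round preserves the invariant. [folklore] -/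
theorem wstepR_todoOK {n T X : ℕ} {s s' : WState} {as as' : List (List Bool)} (hs : TodoOK n s.todo)
    (h : wstepR T s X as = Sum.inr (s', as')) : TodoOK n s'.todo := by
  unfold wstepR at h
  split at h
  · cases h; exact hs
  · rename_i m k rest hsl
    have hmk : 1 ≤ m ∧ m ∣ n := hs (m, k) (by rw [hsl]; simp)
    have hrest : TodoOK n rest := fun e he => hs e (by rw [hsl]; exact List.mem_cons_of_mem _ he)
    split at h
    · simp at h
    · rename_i o as'' hsp
      simp only [Sum.inr.injEq, Prod.mk.injEq] at h
      obtain ⟨rfl, -⟩ := h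
      cases o with
      | some d =>
        obtain ⟨hd1, hdm⟩ := splitStepR_some hmk.1 hsp
        intro e he
        simp only [List.mem_cons] at he
        rcases he with rfl | rfl | he
        · exact ⟨hd1, hdm.trans hmk.2⟩
        · refine ⟨Nat.div_pos (Nat.le_of_dvd hmk.1 hdm) hd1, (Nat.div_dvd_of_dvd hdm).trans hmk.2⟩
        · exact hrest e he
      | none =>
        dsimp only
        split_ifs with hk
        · exact hrest
        · intro e he
          simp only [List.mem_cons] at he
          rcases he with rfl | he
          · exact hmk
          · exact hrest e he

/-- Replays driven by block functions that agree below `t` agree at `t`. [folklore] -/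
theorem wrunR_congr {T : ℕ} {X X' : ℕ → ℕ} (s₀ : WState) (as : List (List Bool)) :
    ∀ t : ℕ, (∀ i < t, X i = X' i) → wrunR T X s₀ t as = wrunR T X' s₀ t as
  | 0, _ => rfl
  | t + 1, h => by
    simp only [wrunR]
    rw [wrunR_congr s₀ as t fun i hi => h i (Nat.lt_succ_of_lt hi), h t (Nat.lt_succ_self t)]

/-! ### The rounds realise the replay -/

/-- The block function read by the rounds: block `t` is the padded block of the coins left
after `t` rounds. [folklore] -/
def Xc (x c : List Bool) (t : ℕ) : ℕ := blockVal x (c.drop ((x.length + 1) * t))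

/-- The blocks read by the rounds are the blocks of the specification (`t < R`). [folklore] -/
theorem Xc_eq_Xof (x c : List Bool) {R t : ℕ} (ht : t < R) :
    Xc x c t = Xof (coinBlocks R (blockLen x.length) c) t := by
  rw [Xof_coinBlocks c ht, Xc, blockVal, blockLen]

/-- **The rounds realise the replay** `Shor1997.wrunR` on the initial record (numbers of the
work list stay `≥ 1` and divisors of `n`, whence within the cap `size m ≤ |x| + 1`; a finished
replay is the record of its state with the coins advanced by `t` blocks; a stuck replay is a
record with status `1 q`, `q` the pending query). [cite: Shor1997SICOMP, §5 pp.15–16 (the classical reduction, replayed round by round)] -/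
theorem iterate_roundF_wrunR (x c : List Bool) (as : List (List Bool)) {n : ℕ} (hn : 1 ≤ n)
    (hxn : n < 2 ^ (x.length + 1)) : ∀ t : ℕ,
    (∀ s as', wrunR (budget x.length) (Xc x c) (winit n (budget x.length)) t as = Sum.inr (s, as') →
      TodoOK n s.todo ∧ roundF^[t] (recOf x c as [(n, budget x.length)] [] []) =
        recOf x (c.drop ((x.length + 1) * t)) as' s.todo s.done []) ∧
    (∀ q, wrunR (budget x.length) (Xc x c) (winit n (budget x.length)) t as = Sum.inl q →
      ∃ c' as' todo done, roundF^[t] (recOf x c as [(n, budget x.length)] [] []) = recOf x c' as' todo done (true :: q))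
  | 0 => by
    refine ⟨fun s as' h => ?_, fun q h => ?_⟩
    · simp only [wrunR, Sum.inr.injEq, Prod.mk.injEq] at h
      obtain ⟨rfl, rfl⟩ := h
      refine ⟨fun e he => ?_, by simp [winit]⟩
      simp only [winit, List.mem_singleton] at he
      subst he
      exact ⟨hn, dvd_rfl⟩
    · simp [wrunR] at h
  | t + 1 => by
    obtain ⟨ih1, ih2⟩ := iterate_roundF_wrunR x c as hn hxn t
    set T := budget x.length with hT
    set ρ₀ := recOf x c as [(n, T)] [] [] with hρ
    rw [Function.iterate_succ_apply']
    rcases hw : wrunR T (Xc x c) (winit n T) t as with q | ⟨s, as'⟩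
    · -- already stuck
      obtain ⟨c', as', todo, done, hrec⟩ := ih2 q hw
      have hw' : wrunR T (Xc x c) (winit n T) (t + 1) as = Sum.inl q := wrunR_of_inl hw (t + 1) (Nat.le_succ t)
      refine ⟨fun s as'' h => ?_, fun q' h => ?_⟩
      · rw [hw'] at h; cases h
      · rw [hw'] at h
        cases h
        exact ⟨c', as', todo, done, by rw [hrec, roundF_recOf_stuck _ _ _ _ _ (List.cons_ne_nil _ _)]⟩
    · obtain ⟨hok, hrec⟩ := ih1 s as' hw
      have hw' : wrunR T (Xc x c) (winit n T) (t + 1) as = wstepR T s (Xc x c t) as' := wrunR_succ_of_inr hw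
      have hdrop : (c.drop ((x.length + 1) * t)).drop (x.length + 1) = c.drop ((x.length + 1) * (t + 1)) := by
        rw [List.drop_drop, Nat.mul_succ]
      obtain ⟨done, todo⟩ := s
      rcases todo with _ | ⟨⟨m, k⟩, rest⟩
      · -- idle round
        have hws : wstepR T ⟨done, []⟩ (Xc x c t) as' = Sum.inr (⟨done, []⟩, as') := rfl
        refine ⟨fun s' as'' h => ?_, fun q h => ?_⟩
        · rw [hw', hws] at h
          simp only [Sum.inr.injEq, Prod.mk.injEq] at h
          obtain ⟨rfl, rfl⟩ := h
          exact ⟨hok, by rw [hrec, roundF_recOf_idle, hdrop]⟩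
        · rw [hw', hws] at h; cases h
      · -- a splitting attempt on the top number `m`
        obtain ⟨hm1, hmn⟩ := hok (m, k) (by simp)
        have hcap : m.size ≤ x.length + 1 :=
          Nat.size_le.2 (lt_of_le_of_lt (Nat.le_of_dvd hn hmn) hxn)
        have hround := roundF_recOf_wstepR x (c.drop ((x.length + 1) * t)) as' done m k rest hm1 hcap
        rw [← hT] at hround
        have hX : blockVal x (c.drop ((x.length + 1) * t)) = Xc x c t := rfl
        rw [hX] at hround
        refine ⟨fun s' as'' h => ?_, fun q h => ?_⟩
        · rw [hw'] at h
          refine ⟨wstepR_todoOK hok h, ?_⟩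
          rw [hrec, hround, h, hdrop]
        · rw [hw'] at h
          exact ⟨_, as', (m, k) :: rest, done, by rw [hrec, hround, h]⟩

/-! ### Sorting canonical numerals -/

/-- On canonical numerals the brick's ordered insertion is `List.orderedInsert` on the values.
[folklore] -/
theorem insModel_map_encodeNat (v : ℕ) (l : List ℕ) :
    Com.insModel (encodeNat v) (l.map encodeNat) = (l.orderedInsert (· ≤ ·) v).map encodeNat := by
  induction l with
  | nil => rfl
  | cons a l ih =>
    simp only [Com.insModel, List.map_cons, List.orderedInsert_cons, bitsToNat_encodeNat] at ih ⊢
    split_ifs <;> simp [ih]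

/-- On canonical numerals the brick's insertion sort is a `foldl` of `List.orderedInsert`.
[folklore] -/
theorem isortModel_map_encodeNat (acc l : List ℕ) :
    Com.isortModel (acc.map encodeNat) (l.map encodeNat) =
      (l.foldl (fun a e => a.orderedInsert (· ≤ ·) e) acc).map encodeNat := by
  induction l generalizing acc with
  | nil => rfl
  | cons e l ih =>
    simp only [Com.isortModel, List.map_cons, List.foldl_cons] at ih ⊢
    rw [insModel_map_encodeNat, ih]

/-- The `foldl` insertion sort is sorted. [folklore] -/
theorem sortedLE_foldl_orderedInsert (l : List ℕ) : ∀ acc : List ℕ, acc.SortedLE →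
    (l.foldl (fun a e => a.orderedInsert (· ≤ ·) e) acc).SortedLE := by
  induction l with
  | nil => intro acc h; exact h
  | cons e l ih =>
    intro acc h
    rw [List.foldl_cons]
    exact ih _ (List.sortedLE_iff_pairwise.2 ((List.sortedLE_iff_pairwise.1 h).orderedInsert e _))

/-- The `foldl` insertion sort is a permutation. [folklore] -/
theorem perm_foldl_orderedInsert (l : List ℕ) : ∀ acc : List ℕ,
    (l.foldl (fun a e => a.orderedInsert (· ≤ ·) e) acc).Perm (acc ++ l) := by
  induction l with
  | nil => intro acc; simp
  | cons e l ih =>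
    intro acc
    rw [List.foldl_cons]
    refine (ih _).trans ?_
    rw [List.append_cons]
    exact List.Perm.append_right l ((List.perm_orderedInsert _ e acc).trans (List.perm_append_singleton e acc).symm)

/-- **The brick sorts like `List.insertionSort`** on lists of canonical numerals. [folklore] -/
theorem isortModel_nil_map_encodeNat (l : List ℕ) :
    Com.isortModel [] (l.map encodeNat) = (l.insertionSort (· ≤ ·)).map encodeNat := by
  have h := isortModel_map_encodeNat [] l
  rw [List.map_nil] at h
  rw [h]
  congr 1
  exact ((perm_foldl_orderedInsert l []).trans (by simpa using (List.perm_insertionSort (· ≤ ·) l).symm)).eq_of_sortedLE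
    (sortedLE_foldl_orderedInsert l [] (List.sortedLE_iff_pairwise.2 List.Pairwise.nil)) List.sortedLE_insertionSort


/-! ### Small bricks: tail, last symbol, canonical numeral -/

/-- `tailF z = z ⇂ 1`. [folklore] -/
def tailF : List Bool → List Bool := sndF ∘ padTakeFn ∘ fanoutFn (fun _ => [true]) idF

/-- Value of `tailF`. [folklore] -/
@[simp] theorem tailF_apply (z : List Bool) : tailF z = z.drop 1 := by
  simp [tailF, idF]

/-- `tailF ∈ FP`. [folklore] -/
theorem tailF_mem_FP : tailF ∈ FP :=
  comp_mem_FP sndF_mem_FP (comp_mem_FP padTakeFn_mem_FP (fanoutFn_mem_FP (const_mem_FP _) idF_mem_FP))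

/-- `lastF z = z ⇂ (|z| - 1)`: the last symbol of `z` (or `ε`). [folklore] -/
def lastF : List Bool → List Bool := sndF ∘ padTakeFn ∘ fanoutFn tailF idF

/-- Value of `lastF`. [folklore] -/
@[simp] theorem lastF_apply (z : List Bool) : lastF z = z.drop (z.length - 1) := by
  simp [lastF, idF]

/-- `lastF ∈ FP`. [folklore] -/
theorem lastF_mem_FP : lastF ∈ FP :=
  comp_mem_FP sndF_mem_FP (comp_mem_FP padTakeFn_mem_FP (fanoutFn_mem_FP tailF_mem_FP idF_mem_FP))

/-- **The canonical numeral of an arbitrary string** (`canonBits`, `ShorOrdPost.lean`): append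
the leading `1` that Mathlib's `decodeNat` reads into a nonempty string ending in `0`.
[folklore] -/
def canonF : List Bool → List Bool :=
  iteFn isNilFn idF (iteFn (parityFn ∘ lastF) (fun z => idF z ++ [true]) idF)

/-- **`canonF = canonBits`.** [folklore] -/
@[simp] theorem canonF_apply (z : List Bool) : canonF z = canonBits z := by
  unfold canonF
  by_cases hz : z = []
  · subst hz
    rw [iteFn_apply_true (by simp [isNilFn])]
    simp [idF, canonBits]
  · rw [iteFn_apply_false (by simp [isNilFn, hz])]
    have hlast : lastF z = [z.getLast hz] := by
      rw [lastF_apply, List.drop_length_sub_one hz]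
    have hgl : z.getLast? = some (z.getLast hz) := List.getLast?_eq_some_getLast hz
    cases hb : z.getLast hz with
    | false =>
      rw [iteFn_apply_true (by rw [Function.comp_apply, hlast, hb]; simp [parityFn])]
      rw [hb] at hgl
      simp [idF, canonBits, hgl]
    | true =>
      rw [iteFn_apply_false (by rw [Function.comp_apply, hlast, hb]; simp [parityFn])]
      rw [hb] at hgl
      simp [idF, canonBits, hgl]

/-- `canonF ∈ FP`. [folklore] -/
theorem canonF_mem_FP : canonF ∈ FP :=
  iteFn_mem_FP isNilFn_mem_FP idF_mem_FP
    (iteFn_mem_FP (comp_mem_FP parityFn_mem_FP lastF_mem_FP) (append_mem_FP idF_mem_FP (const_mem_FP _)) idF_mem_FP)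

/-! ### The initial record -/

/-- The attempt budget `T = 32 (|x| + 1)` as a numeral, from `x`. [folklore] -/
def budget0F : List Bool → List Bool := lenBinF ∘ onesMulFn 32 ∘ List.cons true

/-- Value of `budget0F`. [folklore] -/
@[simp] theorem budget0F_apply (x : List Bool) : budget0F x = encodeNat (budget x.length) := by
  simp [budget0F, onesMulFn, budget]

/-- `budget0F ∈ FP`. [folklore] -/
theorem budget0F_mem_FP : budget0F ∈ FP :=
  comp_mem_FP lenBinF_mem_FP (comp_mem_FP (onesMulFn_mem_FP 32) (cons_mem_FP true))

/-- **The initial record** from the coded pair `⟨w, ⟨u, a⟩⟩` (`w = ⟨x, c⟩` the input, `a` the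
code of the recorded answers): `⟨x, ⟨c, ⟨a, ⟨[canon x], ⟨[T], ⟨[], []⟩⟩⟩⟩⟩⟩`. [folklore] -/
def initF : List Bool → List Bool :=
  mk7 (fstF ∘ fstF) (sndF ∘ fstF) (sndF ∘ sndF) (fanoutFn (canonF ∘ fstF ∘ fstF) (fun _ => []))
    (fanoutFn (budget0F ∘ fstF ∘ fstF) (fun _ => [])) (fun _ => []) (fun _ => [])

/-- `initF ∈ FP`. [folklore] -/
theorem initF_mem_FP : initF ∈ FP :=
  mk7_mem_FP (comp_mem_FP fstF_mem_FP fstF_mem_FP) (comp_mem_FP sndF_mem_FP fstF_mem_FP)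
    (comp_mem_FP sndF_mem_FP sndF_mem_FP)
    (fanoutFn_mem_FP (comp_mem_FP canonF_mem_FP (comp_mem_FP fstF_mem_FP fstF_mem_FP)) (const_mem_FP _))
    (fanoutFn_mem_FP (comp_mem_FP budget0F_mem_FP (comp_mem_FP fstF_mem_FP fstF_mem_FP)) (const_mem_FP _))
    (const_mem_FP _) (const_mem_FP _)

/-- **The initial record is the record of the initial replay configuration.** [folklore] -/
theorem initF_apply (w : List Bool) (as : List (List Bool)) :
    initF (boolPair w ((encodingList Bool).listBool.encode as)) =
      recOf (boolUnpair w).1 (boolUnpair w).2 as [(decodeNat (boolUnpair w).1, budget (boolUnpair w).1.length)] [] [] := by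
  rw [listBool_encode_eq_encList, recOf]
  simp [initF, mk7, fstF, sndF, encList_cons, encodeNat_decodeNat_eq_canonBits]

/-! ### The rounds -/

/-- The round polynomial `64 (X + 1)²`. [folklore] -/
def roundsPoly : Polynomial ℕ := 64 * (X + 1) ^ 2

/-- `roundsPoly` evaluates to `Shor1997.rounds`. [folklore] -/
theorem roundsPoly_eval (L : ℕ) : roundsPoly.eval L = rounds L := by
  simp [roundsPoly, rounds]

/-- **The rounds**: `rounds |x|` applications of `roundF` (`x` the first field). [folklore] -/
def iterF : List Bool → List Bool := fun r => roundF^[roundsPoly.eval (fstF r).length] r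

/-- **`iterF ∈ FP`** (`iterate_mem_FP_of_growth`: `roundF` keeps `x` and grows the record by at
most `300 (|x| + 1)` per round). [cite: AroraBarak2009, §1.3 (bounded loops), §1.4.1] -/
theorem iterF_mem_FP : iterF ∈ FP :=
  iterate_mem_FP_of_growth roundF_mem_FP 300 fstF_roundF length_roundF_le roundsPoly

/-- `iterF` on a record. [folklore] -/
theorem iterF_recOf (x c : List Bool) (as : List (List Bool)) (todo : List (ℕ × ℕ)) (done : List ℕ) (st : List Bool) :
    iterF (recOf x c as todo done st) = roundF^[rounds x.length] (recOf x c as todo done st) := by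
  have hx : fstF (recOf x c as todo done st) = x := xF_recOf x c as done st todo
  simp only [iterF, hx, roundsPoly_eval]

/-! ### The read-out -/

/-- The number of items of a coded list, as a numeral (`takeItemsFn` asked for more items than
there are reports the count). [folklore] -/
def cntF : List Bool → List Bool := nthF 1 ∘ takeItemsFn ∘ fanoutFn (List.cons true ∘ idF) idF

/-- Value of `cntF` on a code. [folklore] -/
theorem cntF_encList (l : List (List Bool)) : cntF (encList l) = encodeNat l.length := by
  have h : l.length < (true :: encList l).length :=
    Nat.lt_succ_of_le (Com.length_le_length_encList l)
  simp [cntF, idF, takeItemsFn_encList_of_lt h]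

/-- `cntF ∈ FP`. [folklore] -/
theorem cntF_mem_FP : cntF ∈ FP :=
  comp_mem_FP (nthF_mem_FP 1) (comp_mem_FP takeItemsFn_mem_FP
    (fanoutFn_mem_FP (comp_mem_FP (cons_mem_FP true) idF_mem_FP) idF_mem_FP))

/-- The number of items of a coded list, in unary. [folklore] -/
def ulenF : List Bool → List Bool := binToUnaryFn ∘ fanoutFn (List.cons true ∘ idF) cntF

/-- Value of `ulenF` on a code. [folklore] -/
theorem ulenF_encList (l : List (List Bool)) : ulenF (encList l) = ones l.length := by
  have h : l.length ≤ (encList l).length + 1 :=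
    (Com.length_le_length_encList l).trans (Nat.le_succ _)
  simp [ulenF, idF, cntF_encList, h]

/-- `ulenF ∈ FP`. [folklore] -/
theorem ulenF_mem_FP : ulenF ∈ FP :=
  comp_mem_FP binToUnaryFn_mem_FP (fanoutFn_mem_FP (comp_mem_FP (cons_mem_FP true) idF_mem_FP) cntF_mem_FP)

/-- The `listBool` framing of a coded list: `⟨1^{#items}, code⟩`. [folklore] -/
def listOutF : List Bool → List Bool := fanoutFn ulenF idF

/-- Value of `listOutF` on a code. [folklore] -/
theorem listOutF_encList (l : List (List Bool)) : listOutF (encList l) = boolPair (ones l.length) (encList l) := by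
  simp [listOutF, idF, ulenF_encList]

/-- `listOutF ∈ FP`. [folklore] -/
theorem listOutF_mem_FP : listOutF ∈ FP := fanoutFn_mem_FP ulenF_mem_FP idF_mem_FP

/-- The `listBool` code of a list of numbers is the framing of the code of their numerals.
[folklore] -/
theorem listNat_encode_eq (l : List ℕ) :
    encodingListNatBool.encode l = boolPair (ones l.length) (encList (l.map encodeNat)) := by
  change boolPair (unaryEncodeNat l.length) (l.foldr (fun a acc => boolPair (encodeNat a) acc) []) = _
  rw [unaryEncodeNat_eq_replicate]
  congr 1
  induction l with
  | nil => rfl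
  | cons a l ih => rw [List.foldr_cons, ih]; rfl

/-- **The read-out**: status `ε` — `1` and the framed sorted `done` list; status `1 q` — `0 q`.
[folklore] -/
def outF : List Bool → List Bool :=
  iteFn (isNilFn ∘ stF) (List.cons true ∘ listOutF ∘ isortFn ∘ dnF) (List.cons false ∘ tailF ∘ stF)

/-- `outF ∈ FP`. [folklore] -/
theorem outF_mem_FP : outF ∈ FP :=
  iteFn_mem_FP (comp_mem_FP isNilFn_mem_FP (sndPow_mem_FP 5))
    (comp_mem_FP (cons_mem_FP true) (comp_mem_FP listOutF_mem_FP (comp_mem_FP isortFn_mem_FP (nthF_mem_FP 5))))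
    (comp_mem_FP (cons_mem_FP false) (comp_mem_FP tailF_mem_FP (sndPow_mem_FP 5)))

/-- **The read-out of a finished replay**: the `sumBool` code of the sorted `done` list.
[folklore] -/
theorem outF_recOf_nil (x c : List Bool) (as : List (List Bool)) (todo : List (ℕ × ℕ)) (done : List ℕ) :
    outF (recOf x c as todo done []) = true :: encodingListNatBool.encode (done.insertionSort (· ≤ ·)) := by
  rw [outF, iteFn_apply_true (by simp [isNilFn])]
  simp only [Function.comp_apply, dnF_recOf, isortFn_encList, isortModel_nil_map_encodeNat]
  rw [listOutF_encList, listNat_encode_eq, List.length_map, List.length_insertionSort]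

/-- **The read-out of a stuck replay**: the `sumBool` code of the pending query. [folklore] -/
theorem outF_recOf_cons (x c : List Bool) (as : List (List Bool)) (todo : List (ℕ × ℕ)) (done : List ℕ) (q : List Bool) :
    outF (recOf x c as todo done (true :: q)) = false :: q := by
  rw [outF, iteFn_apply_false (by simp [isNilFn])]
  simp

/-! ### The step function -/

/-- The answer for `n ≤ 1`: the code of `Sum.inr (encode [])`. [folklore] -/
def nilOut : List Bool := true :: encodingListNatBool.encode ([] : List ℕ)

/-- **The step function of `shorComp` as a string function**: on `⟨⟨x, c⟩, transcript⟩`, answer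
`[]` at once when `decodeNat x ≤ 1`, else initial record, `rounds |x|` rounds, read-out.
[cite: Shor1997SICOMP, §5 pp.15–16 (the classical reduction around order finding)] -/
def stepStr : List Bool → List Bool :=
  iteFn (valGeTwoFn ∘ canonF ∘ fstF ∘ fstF) (outF ∘ iterF ∘ initF) (fun _ => nilOut)

/-- **`stepStr ∈ FP`.** [cite: AroraBarak2009, §1.3 (closure of polynomial time under composition and bounded loops)] -/
theorem stepStr_mem_FP : stepStr ∈ FP :=
  iteFn_mem_FP (comp_mem_FP valGeTwoFn_mem_FP (comp_mem_FP canonF_mem_FP (comp_mem_FP fstF_mem_FP fstF_mem_FP)))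
    (comp_mem_FP outF_mem_FP (comp_mem_FP iterF_mem_FP initF_mem_FP)) (const_mem_FP _)

/-- **`stepStr` computes the `sumBool` code of `Shor1997.shorStep`.** [cite: Shor1997SICOMP, §5 pp.15–16 (the classical reduction around order finding)] -/
theorem stepStr_apply (w : List Bool) (as : List (List Bool)) :
    stepStr (boolPair w ((encodingList Bool).listBool.encode as)) =
      ((encodingList Bool).sumBool (encodingList Bool)).encode (shorStep w as) := by
  rcases hw : boolUnpair w with ⟨x, c⟩
  have htest : (valGeTwoFn ∘ canonF ∘ fstF ∘ fstF) (boolPair w ((encodingList Bool).listBool.encode as)) =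
      [decide (2 ≤ decodeNat x)] := by
    simp [valGeTwoFn, fstF, hw, bitsToNat_canonBits]
  by_cases h1 : decodeNat x ≤ 1
  · rw [stepStr, iteFn_apply_false (by rw [htest]; simp; omega)]
    unfold shorStep
    rw [hw]
    dsimp only
    rw [if_pos h1]
    rfl
  · rw [stepStr, iteFn_apply_true (by rw [htest]; simp; omega)]
    simp only [Function.comp_apply]
    rw [initF_apply, hw]
    simp only []
    rw [iterF_recOf]
    have hX : wrunR (budget x.length) (Xc x c) (winit (decodeNat x) (budget x.length)) (rounds x.length) as =
        wrunR (budget x.length) (Xof (coinBlocks (rounds x.length) (blockLen x.length) c))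
          (winit (decodeNat x) (budget x.length)) (rounds x.length) as :=
      wrunR_congr _ as (rounds x.length) fun i hi => Xc_eq_Xof x c hi
    obtain ⟨hfin, hstuck⟩ :=
      iterate_roundF_wrunR x c as (n := decodeNat x) (by omega) (decodeNat_lt x) (rounds x.length)
    unfold shorStep
    rw [hw]
    dsimp only
    rw [if_neg h1, ← hX]
    rcases hw' : wrunR (budget x.length) (Xc x c) (winit (decodeNat x) (budget x.length)) (rounds x.length) as
      with q | ⟨s, as'⟩
    · obtain ⟨c', as', todo, done, hrec⟩ := hstuck q hw'
      rw [hrec, outF_recOf_cons]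
      rfl
    · obtain ⟨-, hrec⟩ := hfin s as' hw'
      rw [hrec, outF_recOf_nil]
      rfl

end ShorFP

/-! ### The discharge -/

open _root_.Computability Complexity Complexity.OracleComp in
/-- **Discharge of the programming fact `Shor1997.shorComp_isPolyTime`**: the transcript step
function of Shor's classical oracle computation `shorComp` is polynomial time — its G01 step
function is `shorStep` (`ShorReplay.step_shorComp`), computed on the coded pair by the `FP`
string function `ShorFP.stepStr` (`stepStr_apply`). With `shorClassical_mem_FPRel_of`
(`ShorClassicalOracle.lean`) this closes `shorClassical ∈ FP^{orderBitLang}`, one of the named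
facts of `ShorTheoremAssembly.FACT_mem_BQP_of_facts`. Shor (1997, §5, p. 13 of the arXiv
text): "along with a polynomial (in `log n`) amount of post-processing time on a classical
computer that is used to convert the output of the quantum computer to factors of `n`".
[cite: Shor1997SICOMP, §5 pp.13, 15–16 (classical parts of the algorithm are polynomial time)] -/
theorem Shor1997.shorComp_isPolyTime_holds : Shor1997.shorComp_isPolyTime := by
  obtain ⟨p, M, h⟩ := ShorFP.stepStr_mem_FP
  refine ⟨p, M, fun q => ?_⟩
  have hq := h (boolPair q.1 ((encodingList Bool).listBool.encode q.2))
  rw [id, ShorFP.stepStr_apply] at hq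
  have hstep : Function.uncurry (toOracleAlg Shor1997.shorComp).step q = Shor1997.shorStep q.1 q.2 :=
    Shor1997.step_shorComp q.1 q.2
  rw [hstep]
  exact hq

/-- **`shorClassical ∈ FP^{orderBitLang}`** (the named fact `shorClassical_mem_FPRel` of
`ShorAssembly.lean`), now unconditional. [cite: Shor1997SICOMP, §5 pp.15–16 (classical parts of the algorithm are polynomial time)] -/
theorem shorClassical_mem_FPRel_holds : shorClassical_mem_FPRel :=
  shorClassical_mem_FPRel_of Shor1997.shorComp_isPolyTime_holds

end Literature.Computability.Cryptography

end
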